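import Literature.MathematicalPhysics.QuantumFieldTheory.Balaban1983to89.B9Cor36CubeCinvAtOne
import Literature.MathematicalPhysics.QuantumFieldTheory.Balaban1983to89.B9Eq357CubeQpDiffMajorant
import Literature.MathematicalPhysics.QuantumFieldTheory.Balaban1983to89.B9Thm34InvBlk
import Literature.MathematicalPhysics.QuantumFieldTheory.Balaban1983to89.B9Cor36GpCubeIsUnit

/-!
# `Balaban1983to89.B9Cor35CinvAtCubeLetters` — COROLLARY 3.5 ∕ 3.6 FOR THE CUBE LETTER `C_□ = (Q′_□G′_□²Q′_□*)⁻¹`: THEOREM 3.4's C-CLAUSE (*«The inverse satisfies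
# Theorem 3.2»*, p. 403) AT `U = 1` OVER p33's CUBE GEOMETRY, UNIFORMLY IN THE MEMBER AND THE COVER CUBE — r06's `B9Thm34InvBlk.thm34_Cinv_uniform_blk` with every
# `A`-independent binder DISCHARGED at `(g, blk, P, blkP) := (geoCK i □, blkCubeY i □, BlkCubeY i □ × ι, Prod.fst)` (FILES E2-4a∕b∕c + p33's 5a∕5b∕F6∕F7a), and the
# output inverse IDENTIFIED with the record's letter `conj b (η⁻⁴·(XinvCubeY i □ par Ṽ_□)|_ℝ)` by uniqueness of two-sided inverses
# (sub-row G-B9-LETTERS, module M5.2-E, FILE E2-4d; design (β) of `lit-balaban-p21/M52E-DESIGN-p21.md`)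

T. Bałaban, *Propagators for lattice gauge theories in a background field*, Commun. Math. Phys. **99** (1985) 389–434
[`Balaban1985BackgroundPropagators`, "B9"]; [4] = T. Bałaban, *Propagators and renormalization transformations for lattice gauge
theories. II*, Commun. Math. Phys. **96** (1984) 223–250 [`Balaban1984PropagatorsII`].

statement-level skeleton of published theorems with citation tags; proofs where landed; nothing here is a claim about the
Yang–Mills mass gap

THE PRINTED LOCUS (verbatim, held `paper:balaban1985-cmp99-background-propagators`, journal page = PDF page + 388).  Thm 3.4 p. 400 («G′(U′U) = (Δ′_a(U′U))⁻¹ exists»)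
with p. 403 l. 8–12: *«an inverse of the left-hand side can be expressed by a Neumann series convergent for α₁ sufficiently small.  The inverse satisfies Theorem 3.2»*; Thm 3.2
(3.48) p. 398; (3.57) p. 401, (3.59)–(3.60) p. 402; Cor. 3.5 p. 407 (*«with … U = 1, these theorems are proved in [4]»*); Cor. 3.6 p. 408 l. 1–10 (the operators of the sequence
`{Ω_n(□)}` after the gauge transformation (3.35)); p. 409 l. 2–5 (`C_□(U) = (Q′(U)G′²_□(U)Q′*(U))⁻¹`); (3.35)–(3.37) p. 396; [4] Prop. 2.3 (2.86)–(2.87) p. 238, Lemma 2.1 (2.61)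
p. 234, (2.51) p. 232.

WHY THIS FILE (cell `lit-balaban`; module M5.2-E → p21 g34, `lit-balaban-r06/B9-LETTERS-MAP.md` §8).  FILE E2-2's `hasMajorant_conj_smul_cinvLocLetterY` turns ONE cube-side datum
`conj b (c•(XinvCubeY i □ parS Ṽ)|_ℝ) ≺ K_C` over a cube geometry into M5.6's per-cube `hC` binder; FILE E2-3a's transfer wants the same datum inside `K_C` of the defect.  THIS FILE
produces that datum at `c = η⁻⁴` over `(toB6 (geoCK i □) Rr H, Prod.fst)` with `K_C = B·ℓ(a)^{−4}·e^{−δd}`, `(δ, B)` uniform in the member and the cube, for the cut-off (3.37)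
configuration `Ṽ_□ = locCfgY i □ η A` of p33's FILE 4, from r06's Sect.-B C-clause on a general block carrier (`thm34_Cinv_uniform_blk`, R-Ker-1) at base `U = 1`:
* §1 identifications by UNIQUENESS OF TWO-SIDED INVERSES (no series is re-summed): ★ `eq_conj_GpCubeY_of_laws` (a two-sided inverse of `conj b(η⁻²Δ′_{a,□}(V))` IS
  `conj b(η²G′_□(V))`, `G′_□ = Ring.inverse Δ′_{a,□}` — so r06's word `gPrimeExtEnd Gp (conj b V′(A)·Gp)` of p33's `cor35_Gp_cube` is the record's `G′_□(Ṽ_□)`),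
  ★ `conjHom_Qp_conj_sq_Qps_eq` (`Q̂′(V) ∘ (conj b η²G′_□(V))² ∘ Q̂′*(V) = conj b(η⁴X̂_□(V))`), ★ `eq_conj_XinvCubeY_of_laws` (a two-sided inverse of `conj b(η⁴X̂_□(V))` IS
  `conj b(η⁻⁴C_□(V))`, `C_□ = XinvCubeY = Ring.inverse X̂_□`, and `X̂_□(V)` is a unit);
* §2 ★★★ `cor35_Cinv_cube` — there are `δ, B > 0`, thresholds `M₀, T₀, N₀` and `a₁ > 0` (functions of `d, L, M₂, C_q` only) such that for every member above the thresholds,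
  every cover cube, every transporter letter with `par 1 = 1`, every `0 ≦ α₁ ≦ a₁` and every vector potential `A` whose cut-off `χ̃_□A` obeys the seven blockwise (3.37)∕(3.59)
  readings of p33's `cor35_Gp_cube` and whose (3.57) letters obey the two pointwise (3.59) sizes `τ = C_q·α₁` (FILE E2-4c): `X̂_□(Ṽ_□)` is a unit and
  `conj b (η⁻⁴·C_□(Ṽ_□)|_ℝ) ≺ B·ℓ(a)^{−4}·e^{−δd}` over `(toB6 (geoCK i □) Rr H, Prod.fst)`.

HOW (assembly, ours).  Constants: `δ₀ := min δ₁ (δ₂∕2)` below r05's flat (3.42) rate `δ₁` (`thm31_cube_allOrientations`) and flat (3.48) rate `δ₂∕2` (`thm32_cubeW_flat`); ONE (2.61)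
exponent at `δ₀` (`exists_h261_geoCK`); `Λ(·) := L⁴` (`hST_geoCK`); `κ_Q := M₂Σ‖b‖ + 1`, `c_F := M₂Σ‖b‖C_q + 1`, `a₀ = d₀ = 1`; `a₁ := min (a₁ of cor35_Gp_cube) (a₁ of
thm34_Cinv_uniform_blk)`; output `(δ, B) := (9δ₀∕25, 2C₂c₁(d_B, 2δ₀∕5, 1∕10) + 1)`.  Binders: geometry (p33 5a), `V′(1)` data (p33 5b), (3.42)₁,₂ (p33 5b∕F6 §1, rates weakened
to `δ₀`), `hQc`∕`hQcs` (E2-4a), `hLinv`∕`h348` (E2-4b + `thm32_cubeW_flat` at the member's `(D, P ≥ 4, R ≥ 2L)`), `hFc`∕`hFcs` (E2-4c), `Qc′ = Qc + Fc` (E2-4c); the word laws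
from p33's `cor35_Gp_cube` + `DpK_sub_conj_vPrimeConc`; then §1.

HONEST SCOPE.  The (3.37)∕(3.59) readings of `χ̃_□A` and the two pointwise (3.59) sizes are DISPLAYED HYPOTHESES (p33's FILE 7a `isUnit_and_localInverse_laws` and r05's
`B9Eq357CubeLetters.norm_QpCubeY_sub_one_apply_le` discharge them from the (3.35) cube datum at `parSymY`; not repeated here); thresholds displayed; `‖1‖ ≦ 1`.  Count-neutral;
no summit ∕ sub-problem statement is proved; nothing continuum ∕ OS ∕ mass-gap ∕ Clay; NOT a node discharge.  No `sorry`, no `axiom`, no `… : Prop` fact, no `instance`, no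
`notation`, no `def`.  NEW file; nothing landed is modified.  Cell `lit-balaban`, seat `lit-balaban-p21` gen 34, 2026-08-28; `--supports stmt-QuantumFields-19200` as helper.
Net new unproved facts: 0.

RELATED IN THE TREE, NOT DUPLICATED (searched 2026-08-28): p33 `B9Cor35GpAtCubeLetters.cor35_Gp_cube` (the G′-sector twin — USED for the word laws, pattern mirrored),
`B9Cor36GpCubeIsUnit` (`DpK_sub_conj_vPrimeConc`; its `isUnit_and_localInverse_laws` discharges the A-readings), `B9Eq359CubeKernelsAtOne.isUnit_of_conj_laws`,
`B9CubeGeometryInputs`, `B9Cor35GpCubeInputsAtOne`; r06 `B9Thm34InvBlk.thm34_Cinv_uniform_blk` (the engine, USED BY NAME); r05 `B9Thm31CubeLocalFlat.thm32_cubeW_flat`,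
`B9CubeLettersBondOpsL0` (`XinvCubeY := Ring.inverse X̂_□`), `B9CubeLettersOpsL0` (`GpCubeY := Ring.inverse Δ′_{a,□}`); p21 E2-4a∕b∕c — no existing module modified.
-/

noncomputable section

namespace Literature.MathematicalPhysics.QuantumFieldTheory.Balaban1983to89.B9Cor35CinvAtCubeLetters

open B6KLevelCensusIndexV1 (KIdx kGeo)
open B6Cover236MultiLevelBlocks (cubes)
open B6RandomWalk (HasMajorant BlockSupp hasMajorant_mono Triangle254 Ineq261 c1_nonneg)
open B6RandomWalkHom (HasMajorantHom hasMajorantHom_mono)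
open B9Thm34Ext (toB6)
open B9Ineq347 (ScaleTransfer)
open B9Eq352DivFormLetters (conj)
open B9Eq352GradLetters (diffLetter)
open B9Eq360Vprime (gPrimeExtEnd)
open B9Eq360VprimeLetters (vPrimeConc)
open B9Eq39Adjoint (covD covDstar)
open B9Eq352DivForm (tauB)
open B9Eq376POneLetters (conjHom conjHom_comp conjHom_eq_conj)
open B9Thm34InvBlk (thm34_Cinv_uniform_blk)
open B9Thm31CubeLocalFlat (thm32_cubeW_flat)
open B9CubeLettersOpsL0 (cubeFamY oddMh GpCubeY deltaPrimeACubeY deltaPrimeACubeY_mul_GpCubeY)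
open B9CubeLettersBondOpsL0 (BlkCubeY qpKc qpsKc QpCubeY QpsCubeY XCubeY XinvCubeY XCubeY_mul_XinvCubeY)
open B9CubeLettersBondOpsAtOneL0 (xinvKc)
open B9Eq360DeltaPrimeAY (AfldY chartA)
open B9Eq360DeltaPrimeACubeY (blkCubeY kQCubeY sQCubeY kFCubeY sFCubeY)
open B9CubeGeometryInputs (geoCK geoCK_len geoCK_eta geoCK_eta_pos geoCK_len_pos geoCK_eta_le_len geoCK_dist_axioms stencil_geoCK geoCK_site_nonempty hST_geoCK
  exists_h261_geoCK N1 RM1)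
open B9Cor35GpCubeInputsAtOne (GpK DpK wK cfunK wK_nonneg card_block_mul_wK_le norm_kQCubeY_one_le norm_sQCubeY_one_le abs_cfunK_le eta_ne_zero conj_one'
  h342_1_cube h342_2_cube_inl h342_2_cube_inr)
open B9Cor35GpAtCubeLetters (cor35_Gp_cube thm31_cube_allOrientations hasMajorant_geomT_of_toB6)
open B9Cor36CutoffField337 (cutFldY)
open B9Cor36CubeCutoffs (chiTY locCfgY)
open B9Cor36GpCubeIsUnit (DpK_sub_conj_vPrimeConc)
open B9Eq359CubeKernelsAtOne (isUnit_of_conj_laws)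
open B9Cor36CubeSandwichQ (hasMajorantHom_conjHom_QpCubeY hasMajorantHom_conjHom_QpsCubeY smul_XCubeY_restrictScalars)
open B9Cor36CubeCinvAtOne (CinvK hLinv_cube h348_cube xinvKc_abs_le_of_kernel_bound)
open B9Eq357CubeQpDiffMajorant (conjHom_restrictScalars_eq_add hasMajorantHom_conjHom_QpCubeY_sub hasMajorantHom_conjHom_QpsCubeY_sub)
open Node00 (SiteY CfgY SiteParY toKT shiftY)

variable {d ℓ : ℕ} {hd : 1 ≤ d + 1} {hL : Odd (ℓ + 1) ∧ 1 < ℓ + 1} {b₀ b₁ : ℝ}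
variable {𝔸 : Type} [NormedRing 𝔸] [NormedAlgebra ℂ 𝔸] [CompleteSpace 𝔸]
variable {ι : Type} [Fintype ι] (b : Module.Basis ι ℝ 𝔸)

/-! ## §1 Identifications by uniqueness of two-sided inverses -/

section Ident

variable (i : KIdx d ℓ hd hL b₀ b₁) (c : ↥(cubes (toKT i).D.toDomains)) (par : SiteParY 𝔸 i) (V : CfgY 𝔸 i)

/-- ★ **A TWO-SIDED INVERSE OF `conj b(η⁻²Δ′_{a,□}(V))` IS `conj b(η²G′_□(V))`** (`G′_□ = Ring.inverse Δ′_{a,□}`), and `Δ′_{a,□}(V)` is a unit — so r06's word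
`gPrimeExtEnd Gp (conj b V′(A)·Gp)` of `cor35_Gp_cube`, a two-sided inverse of `Δp − conj b V′(A) = conj b(η⁻²Δ′_{a,□}(Ṽ_□))`, is the record's `G′_□(Ṽ_□)`.
[cite: Balaban1985BackgroundPropagators, Thm 3.4 p.400 («G′(U′U) = (Δ′_a(U′U))⁻¹ exists»), (3.64)–(3.65) p.402, p.409 l.2–5] -/
theorem eq_conj_GpCubeY_of_laws {W : Module.End ℝ (SiteY i × ι → ℝ)}
    (h1 : conj b ((((kGeo i).eta ^ 2)⁻¹) • (deltaPrimeACubeY i c par V).restrictScalars ℝ) * W = 1)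
    (h2 : W * conj b ((((kGeo i).eta ^ 2)⁻¹) • (deltaPrimeACubeY i c par V).restrictScalars ℝ) = 1) :
    IsUnit (deltaPrimeACubeY i c par V) ∧ W = conj b (((kGeo i).eta ^ 2) • (GpCubeY i c par V).restrictScalars ℝ) := by
  have hη2 : ((kGeo i).eta ^ 2 : ℝ) ≠ 0 := pow_ne_zero 2 (eta_ne_zero i)
  have hunit : IsUnit (deltaPrimeACubeY i c par V) := isUnit_of_conj_laws b _ (inv_ne_zero hη2) W h1 h2
  refine ⟨hunit, left_inv_eq_right_inv h2 ?_⟩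
  rw [← B9Eq352DivFormLetters.conj_mul, smul_mul_smul_comm, inv_mul_cancel₀ hη2, one_smul, Module.End.mul_eq_comp, ← LinearMap.restrictScalars_comp,
    ← Module.End.mul_eq_comp, deltaPrimeACubeY_mul_GpCubeY i c par V hunit]
  exact conj_one' b

/-- ★ `Q̂′(V) ∘ (conj b η²G′_□(V))·(conj b η²G′_□(V)) ∘ Q̂′*(V) = conj b (η⁴·(Q′_□G′_□²Q′_□*)(V))`.
[cite: Balaban1985BackgroundPropagators, (3.25) p.394, p.409 l.2–5; Balaban1984PropagatorsII, (2.52) p.232] -/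
theorem conjHom_Qp_conj_sq_Qps_eq :
    conjHom b ((QpCubeY i c par V).restrictScalars ℝ) ∘ₗ
        (conj b (((kGeo i).eta ^ 2) • (GpCubeY i c par V).restrictScalars ℝ) * conj b (((kGeo i).eta ^ 2) • (GpCubeY i c par V).restrictScalars ℝ)) ∘ₗ
        conjHom b ((QpsCubeY i c par V).restrictScalars ℝ) =
      conj b (((kGeo i).eta ^ 4) • (XCubeY i c par V).restrictScalars ℝ) := by
  rw [← B9Eq352DivFormLetters.conj_mul, smul_mul_smul_comm, ← pow_add, show 2 + 2 = 4 from rfl, smul_XCubeY_restrictScalars, ← conjHom_eq_conj,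
    ← conjHom_eq_conj, conjHom_comp, conjHom_comp]

/-- ★ **A TWO-SIDED INVERSE OF `conj b(η⁴X̂_□(V))` IS `conj b(η⁻⁴C_□(V))`** (`C_□ = XinvCubeY = Ring.inverse X̂_□`), and `X̂_□(V)` is a unit — so Theorem 3.4's inverse `Tinv` of
the C-clause is the record's letter. [cite: Balaban1985BackgroundPropagators, Thm 3.2 p.398, p.403 l.8–12 («The inverse satisfies Theorem 3.2»), p.409 l.2–5] -/
theorem eq_conj_XinvCubeY_of_laws {Y : Module.End ℝ (BlkCubeY i c × ι → ℝ)}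
    (h1 : Y * conj b (((kGeo i).eta ^ 4) • (XCubeY i c par V).restrictScalars ℝ) = 1)
    (h2 : conj b (((kGeo i).eta ^ 4) • (XCubeY i c par V).restrictScalars ℝ) * Y = 1) :
    IsUnit (XCubeY i c par V) ∧ Y = conj b ((((kGeo i).eta ^ 4)⁻¹) • (XinvCubeY i c par V).restrictScalars ℝ) := by
  have hη4 : ((kGeo i).eta ^ 4 : ℝ) ≠ 0 := pow_ne_zero 4 (eta_ne_zero i)
  have hunit : IsUnit (XCubeY i c par V) := isUnit_of_conj_laws b _ hη4 Y h2 h1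
  refine ⟨hunit, left_inv_eq_right_inv h1 ?_⟩
  rw [← B9Eq352DivFormLetters.conj_mul, smul_mul_smul_comm, mul_inv_cancel₀ hη4, one_smul, Module.End.mul_eq_comp, ← LinearMap.restrictScalars_comp,
    ← Module.End.mul_eq_comp, XCubeY_mul_XinvCubeY i c hunit]
  exact conj_one' b

end Ident

/-! ## §2 ★★★ Corollary 3.5 ∕ 3.6 for `C_□`: Theorem 3.2 for `(Q′_□G′_□²Q′_□*)⁻¹(Ṽ_□)` over the cube geometry, uniformly -/

section Main

omit [CompleteSpace 𝔸] in
/-- rate weakening of an exponential block majorant. [cite: Balaban1984PropagatorsII, (2.51) p.232, bookkeeping] -/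
theorem kernel_rate_mono {G : B9.Geometry} (hdnn : ∀ a a' : G.Site, 0 ≤ G.dist a a') {δ δ' F : ℝ} (hδ : δ' ≤ δ) (hF : 0 ≤ F) (a a' : G.Site) :
    F * Real.exp (-(δ * G.dist a a')) ≤ F * Real.exp (-(δ' * G.dist a a')) :=
  mul_le_mul_of_nonneg_left (Real.exp_le_exp.2 (by nlinarith [hdnn a a'])) hF

/-- ★★★ **COROLLARY 3.5 ∕ 3.6 FOR THE CUBE LETTER `C_□ = (Q′_□G′_□²Q′_□*)⁻¹` — THEOREM 3.4's C-CLAUSE AT `U = 1` OVER THE CUBE SEQUENCE, UNIFORMLY IN THE MEMBER AND THE COVER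
CUBE**: there are `δ, B > 0`, thresholds `M₀, T₀, N₀` and `a₁ > 0` — functions of `d, L`, the basis datum `M₂` and the (3.59) size `C_q` only — such that for every member above the
thresholds, every cover cube `□`, every transporter letter with `par 1 = 1`, every `0 ≦ α₁ ≦ a₁` and every vector potential `A` whose cut-off `χ̃_□A` (chart `chartA`) obeys the blockwise
(3.37) bounds over the cube blocks with the (3.59) kernels `kF = kQ(Ṽ_□) − kQ(1)`, `sF = sQ(Ṽ_□) − sQ(1)` of size `C_q·α₁`, and whose (3.57) letters `Q′_□(Ṽ_□) − Q′_□(1)`,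
`Q′_□*(Ṽ_□) − Q′_□*(1)` obey the pointwise (3.59) sizes `C_q·α₁·Q̃′|λ|`: the cube operator `X̂_□(Ṽ_□) = (Q′_□G′_□²Q′_□*)(Ṽ_□)` IS A UNIT and its inverse in print's units,
`conj b (η⁻⁴·C_□(Ṽ_□)|_ℝ)`, has the Theorem-3.2 block majorant `B·ℓ(a)^{−4}·e^{−δd(a,a′)}` over `(toB6 (geoCK i □) Rr H, Prod.fst)`.
[cite: Balaban1985BackgroundPropagators, Cor. 3.5 p.407, Cor. 3.6 p.408, Thm 3.4 p.400, p.403 l.8–12, Thm 3.2 (3.48) p.398, (3.57)–(3.60) pp.401–402, p.409 l.2–5; Balaban1984PropagatorsII, Prop. 2.3 (2.86)–(2.87) p.238, Lemma 2.1 p.234] -/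
theorem cor35_Cinv_cube [DecidableEq ι] (d ℓ : ℕ) (hℓ : 1 ≤ ℓ) (Cq M₂ : ℝ) (hCq : 0 ≤ Cq) (hM₂ : 0 ≤ M₂) (hrepr : ∀ (v : 𝔸) (j : ι), |b.repr v j| ≤ M₂ * ‖v‖)
    (h1 : ‖(1 : 𝔸)‖ ≤ 1) :
    ∃ δ B M₀ T₀ : ℝ, ∃ N₀ : ℕ, 0 < δ ∧ 0 < B ∧ ∃ a₁ : ℝ, 0 < a₁ ∧
    ∀ {hd : 1 ≤ d + 1} {hL : Odd (ℓ + 1) ∧ 1 < ℓ + 1} {b₀ b₁ : ℝ} (i : KIdx d ℓ hd hL b₀ b₁) (c : ↥(cubes (toKT i).D.toDomains)) (Rr : ℝ) (H : Prop)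
      (par : SiteParY 𝔸 i), (∀ z w, par (fun _ _ => 1) z w = 1) →
      M₀ ≤ ((ℓ : ℝ) + 1) * (toKT i).Mh → N₀ + 1 ≤ (toKT i).R * ((ℓ + 1) * (toKT i).Mh) → T₀ ≤ RM1 i →
    ∀ (α₁ : ℝ), 0 ≤ α₁ → α₁ ≤ a₁ →
    ∀ (A : AfldY 𝔸 i),
      (∀ y x, blkCubeY i c x = y → ‖kFCubeY i c par (fun _ _ => 1) (locCfgY i c (kGeo i).eta A) y x‖ ≤ Cq * α₁ * wK i c y) →
      (∀ x, ‖sFCubeY i c par (fun _ _ => 1) (locCfgY i c (kGeo i).eta A) x‖ ≤ Cq * α₁) →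
      (∀ ν k x, ‖(((geoCK i c).eta : ℂ)⁻¹) • covDstar (shiftY i) (fun _ _ => (1 : 𝔸ˣ)) ν (chartA i (cutFldY i (chiTY i c) A) k) x‖ ≤
        α₁ * ((geoCK i c).len (blkCubeY i c x) ^ 2)⁻¹) →
      (∀ μ ν x, ‖(((geoCK i c).eta : ℂ)⁻¹) • covD (shiftY i) (fun _ _ => (1 : 𝔸ˣ)) μ (chartA i (cutFldY i (chiTY i c) A) ν) x‖ ≤
        α₁ * ((geoCK i c).len (blkCubeY i c x) ^ 2)⁻¹) →
      (∀ μ x, ‖(((geoCK i c).eta : ℂ)⁻¹) • covDstar (shiftY i) (fun _ _ => (1 : 𝔸ˣ)) μ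
          (tauB (shiftY i) (fun _ _ => (1 : 𝔸ˣ)) μ (chartA i (cutFldY i (chiTY i c) A) μ)) x‖ ≤ α₁ * ((geoCK i c).len (blkCubeY i c x) ^ 2)⁻¹) →
      (∀ k x, ‖chartA i (cutFldY i (chiTY i c) A) k x‖ ≤ α₁ * ((geoCK i c).len (blkCubeY i c x))⁻¹) →
      (∀ ν k x, ‖tauB (shiftY i) (fun _ _ => (1 : 𝔸ˣ)) ν (chartA i (cutFldY i (chiTY i c) A) k) x‖ ≤ α₁ * ((geoCK i c).len (blkCubeY i c x))⁻¹) →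
      (∀ (s : BlkCubeY i c) (lam : SiteY i → 𝔸),
        ‖(QpCubeY i c par (locCfgY i c (kGeo i).eta A) lam - QpCubeY i c par (fun _ _ => 1) lam) s‖ ≤ Cq * α₁ * ∑ z, |qpKc i c s z| * ‖lam z‖) →
      (∀ (z : SiteY i) (nu : BlkCubeY i c → 𝔸),
        ‖(QpsCubeY i c par (locCfgY i c (kGeo i).eta A) nu - QpsCubeY i c par (fun _ _ => 1) nu) z‖ ≤ Cq * α₁ * ∑ s, |qpsKc i c z s| * ‖nu s‖) →
      IsUnit (XCubeY i c par (locCfgY i c (kGeo i).eta A)) ∧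
      HasMajorant (g := toB6 (geoCK i c) Rr H) (fun q : BlkCubeY i c × ι => q.1)
        (conj b ((((kGeo i).eta ^ 4)⁻¹) • (XinvCubeY i c par (locCfgY i c (kGeo i).eta A)).restrictScalars ℝ))
        (fun a a' => B * (geoCK i c).len a ^ (-(4 : ℝ)) * Real.exp (-(δ * (geoCK i c).dist a a'))) := by
  classical
  have hSb : 0 ≤ ∑ j, ‖b j‖ := Finset.sum_nonneg fun j _ => norm_nonneg _
  -- r05's flat Theorem 3.1 (all orientations, p33 F6 §1) and flat Theorem 3.2 (kernel form) for the cube sequence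
  obtain ⟨δ₁, C₁, M₁, T₁, N₁', hδ₁, hC₁, h31⟩ := thm31_cube_allOrientations d ℓ hℓ
  obtain ⟨δ₂, C₂, M₂', hδ₂, hC₂, -, h32⟩ := thm32_cubeW_flat d ℓ hℓ
  -- p33's Theorem 3.4 at the cube for `G′_□` (the word laws)
  obtain ⟨δG, BG, MG, TG, NG, -, -, aG, haG, BB, -, hG⟩ := cor35_Gp_cube b d ℓ hℓ Cq M₂ hCq hM₂ hrepr h1
  -- one rate below both flat rates
  set δ₀ : ℝ := min δ₁ (δ₂ / 2) with hδ₀def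
  have hδ₀ : 0 < δ₀ := lt_min hδ₁ (half_pos hδ₂)
  have hδ₀1 : δ₀ ≤ δ₁ := min_le_left _ _
  have hδ₀2 : δ₀ ≤ δ₂ / 2 := min_le_right _ _
  obtain ⟨dB, h261⟩ := exists_h261_geoCK d ℓ hδ₀
  have hΛf : ∀ α : ℝ, 0 < α → (1 : ℝ) ≤ ((ℓ : ℝ) + 1) ^ 4 := fun α _ =>
    one_le_pow₀ (by linarith [(Nat.cast_nonneg ℓ : (0 : ℝ) ≤ ℓ)])
  set κQ : ℝ := M₂ * (∑ j, ‖b j‖) + 1 with hκQdef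
  have hκQ : 0 < κQ := by rw [hκQdef]; nlinarith
  set cF : ℝ := M₂ * (∑ j, ‖b j‖) * Cq + 1 with hcFdef
  have hcF : 0 < cF := by rw [hcFdef]; nlinarith [mul_nonneg (mul_nonneg hM₂ hSb) hCq]
  obtain ⟨aC, haC, H34⟩ := thm34_Cinv_uniform_blk b (Fin (d + 1)) dB δ₀ κQ C₁ C₂ cF Cq 1 1 M₂ (fun _ => ((ℓ : ℝ) + 1) ^ 4) hκQ hC₁ hC₂ hcF hCq
    zero_le_one hM₂ hδ₀ hΛf hrepr
  have hc1 : 0 ≤ B6.c1 dB (2 / 5 * δ₀) (1 / 10) := c1_nonneg _ _ _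
  refine ⟨9 / 25 * δ₀, 2 * C₂ * B6.c1 dB (2 / 5 * δ₀) (1 / 10) + 1, max (max M₁ M₂') MG, max (max T₁ (4 * Real.log ((ℓ : ℝ) + 1) / (9 / 5000 * δ₀))) TG,
    max (max N₁' (N1 d ℓ (9 / 5000 * δ₀))) NG, by positivity, by positivity, min aG aC, lt_min haG haC, ?_⟩
  intro hd hL b₀ b₁ i c Rr H par hpar hM hN hT α₁ hα0 hα1 A hkF hsF h337B h337F h337Bτ hA hAτB hF hFs
  -- thresholds
  have hM1 : M₁ ≤ ((ℓ : ℝ) + 1) * (toKT i).Mh := ((le_max_left _ _).trans (le_max_left _ _)).trans hM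
  have hM2 : M₂' ≤ ((ℓ : ℝ) + 1) * (toKT i).Mh := ((le_max_right _ _).trans (le_max_left _ _)).trans hM
  have hMG : MG ≤ ((ℓ : ℝ) + 1) * (toKT i).Mh := (le_max_right _ _).trans hM
  have hN1 : N₁' + 1 ≤ (toKT i).R * ((ℓ + 1) * (toKT i).Mh) := le_trans (Nat.succ_le_succ ((le_max_left _ _).trans (le_max_left _ _))) hN
  have hN2 : N1 d ℓ (9 / 5000 * δ₀) + 1 ≤ (toKT i).R * ((ℓ + 1) * (toKT i).Mh) :=
    le_trans (Nat.succ_le_succ ((le_max_right _ _).trans (le_max_left _ _))) hN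
  have hNG : NG + 1 ≤ (toKT i).R * ((ℓ + 1) * (toKT i).Mh) := le_trans (Nat.succ_le_succ (le_max_right _ _)) hN
  have hT1 : T₁ ≤ RM1 i := ((le_max_left _ _).trans (le_max_left _ _)).trans hT
  have hT2 : 4 * Real.log ((ℓ : ℝ) + 1) / (9 / 5000 * δ₀) ≤ RM1 i := ((le_max_right _ _).trans (le_max_left _ _)).trans hT
  have hTG : TG ≤ RM1 i := (le_max_right _ _).trans hT
  -- the word `gPrimeExtEnd Gp (conj b V′·Gp)` IS `conj b(η²G′_□(Ṽ_□))`
  obtain ⟨hw1, hw2, -, -⟩ := hG i c Rr H par hpar hMG hNG hTG α₁ hα0 (hα1.trans (min_le_left _ _)) (chartA i (cutFldY i (chiTY i c) A))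
    (kFCubeY i c par (fun _ _ => 1) (locCfgY i c (kGeo i).eta A)) (sFCubeY i c par (fun _ _ => 1) (locCfgY i c (kGeo i).eta A))
    hkF hsF h337B h337F h337Bτ hA hAτB
  rw [DpK_sub_conj_vPrimeConc] at hw1 hw2
  obtain ⟨-, hW⟩ := eq_conj_GpCubeY_of_laws b i c par _ hw1 hw2
  -- geometry of the cube sequence (p33 5a)
  haveI : Nonempty (geoCK i c).Site := geoCK_site_nonempty i c
  obtain ⟨hdnn, htri, hrefl, hsym⟩ := geoCK_dist_axioms i c Rr H
  obtain ⟨hd₀B, hd₀F, hd₀0⟩ := stencil_geoCK i c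
  -- Theorem 3.1 (3.42)₁,₂ for `G′_□(1)` in conj-`b` form at the rate `δ₀`
  obtain ⟨e1, e2, -, e2', -⟩ := h31 i c Rr H hM1 hN1 hT1
  have g342_1 : HasMajorant (g := toB6 (geoCK i c) Rr H) (fun p : SiteY i × ι => blkCubeY i c p.1) (GpK b i c par)
      (fun a a' => C₁ * (geoCK i c).len a ^ 2 * Real.exp (-(δ₀ * (geoCK i c).dist a a'))) :=
    hasMajorant_mono (g := toB6 (geoCK i c) Rr H) _ (h342_1_cube b i c par hpar Rr H (hasMajorant_geomT_of_toB6 i c Rr H e1))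
      fun a a' => kernel_rate_mono hdnn hδ₀1 (mul_nonneg hC₁.le (sq_nonneg _)) a a'
  have g342_2 : ∀ k : Fin (d + 1) ⊕ Fin (d + 1), HasMajorant (g := toB6 (geoCK i c) Rr H) (fun p : SiteY i × ι => blkCubeY i c p.1)
      (conj b (diffLetter (shiftY i) (fun _ _ => (1 : 𝔸ˣ)) ((((geoCK i c).eta : ℂ))⁻¹) k) * GpK b i c par)
      (fun a a' => C₁ * (geoCK i c).len a * Real.exp (-(δ₀ * (geoCK i c).dist a a'))) := by
    rintro (μ | μ)
    · exact hasMajorant_mono (g := toB6 (geoCK i c) Rr H) _ (h342_2_cube_inl b i c par hpar Rr H μ (hasMajorant_geomT_of_toB6 i c Rr H (e2 μ)))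
        fun a a' => kernel_rate_mono hdnn hδ₀1 (mul_nonneg hC₁.le (geoCK_len_pos i c a).le) a a'
    · exact hasMajorant_mono (g := toB6 (geoCK i c) Rr H) _ (h342_2_cube_inr b i c par hpar Rr H μ (e2' μ))
        fun a a' => kernel_rate_mono hdnn hδ₀1 (mul_nonneg hC₁.le (geoCK_len_pos i c a).le) a a'
  -- the (3.19) letters at `U = 1` (FILE E2-4a), constant `κ_Q`
  have hκle : M₂ * (∑ j, ‖b j‖) ≤ κQ := by rw [hκQdef]; linarith
  have hpar1 : ∀ z w : SiteY i, ‖((par (fun _ _ => 1) z w : 𝔸ˣ) : 𝔸)‖ ≤ 1 ∧ ‖(((par (fun _ _ => 1) z w)⁻¹ : 𝔸ˣ) : 𝔸)‖ ≤ 1 := fun z w => by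
    rw [hpar z w, inv_one, Units.val_one]; exact ⟨h1, h1⟩
  have hQc := hasMajorantHom_mono (g := toB6 (geoCK i c) Rr H) _ _
    (hasMajorantHom_conjHom_QpCubeY i c b par (fun _ _ => 1) (Rr := Rr) (Hp := H) hpar1 hM₂ hrepr)
    (K' := fun a a' : BlkCubeY i c => κQ * (if a = a' then (1 : ℝ) else 0)) fun a a' => by
      split_ifs
      · rw [mul_one]; exact hκle
      · rw [mul_zero]
  have hQcs := hasMajorantHom_mono (g := toB6 (geoCK i c) Rr H) _ _
    (hasMajorantHom_conjHom_QpsCubeY i c b par (fun _ _ => 1) (Rr := Rr) (Hp := H) hpar1 hM₂ hrepr)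
    (K' := fun a a' : BlkCubeY i c => κQ * (if a = a' then (1 : ℝ) else 0)) fun a a' => by
      split_ifs
      · rw [mul_one]; exact hκle
      · rw [mul_zero]
  -- Theorem 3.2 at `U = 1` (FILE E2-4b): the law and the (3.48) majorant at the rate `δ₀`
  have hLinv := hLinv_cube b i c par hpar
  have h348 : HasMajorant (g := toB6 (geoCK i c) Rr H) (fun q : BlkCubeY i c × ι => q.1) (CinvK b i c par)
      (fun a a' => C₂ * (geoCK i c).len a ^ (-(4 : ℝ)) * Real.exp (-(δ₀ * (geoCK i c).dist a a'))) := by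
    obtain ⟨-, -, -, hker⟩ := h32 (toKT i).D c hL.1 (oddMh i) (toKT i).hMh (toKT i).hP (toKT i).hP4 (toKT i).hR hM2
    exact hasMajorant_mono (g := toB6 (geoCK i c) Rr H) _ (h348_cube b i c par hpar Rr H (xinvKc_abs_le_of_kernel_bound i c hker))
      fun a a' => kernel_rate_mono hdnn hδ₀2 (mul_nonneg hC₂.le (Real.rpow_nonneg (geoCK_len_pos i c a).le _)) a a'
  -- the (3.57) letters (FILE E2-4c), constant `c_F·α₁`
  have hcle : M₂ * (∑ j, ‖b j‖) * (Cq * α₁) ≤ cF * α₁ := by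
    rw [hcFdef]; nlinarith [mul_nonneg (mul_nonneg hM₂ hSb) hCq]
  have hFc := hasMajorantHom_mono (g := toB6 (geoCK i c) Rr H) _ _
    (hasMajorantHom_conjHom_QpCubeY_sub i c b par (locCfgY i c (kGeo i).eta A) (fun _ _ => 1) (Rr := Rr) (Hp := H) hM₂ hrepr (by positivity) hF)
    (K' := fun a a' : BlkCubeY i c => cF * α₁ * (if a = a' then (1 : ℝ) else 0)) fun a a' => by
      split_ifs
      · rw [mul_one]; exact hcle
      · rw [mul_zero]
  have hFcs := hasMajorantHom_mono (g := toB6 (geoCK i c) Rr H) _ _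
    (hasMajorantHom_conjHom_QpsCubeY_sub i c b par (locCfgY i c (kGeo i).eta A) (fun _ _ => 1) (Rr := Rr) (Hp := H) hM₂ hrepr (by positivity) hFs)
    (K' := fun a a' : BlkCubeY i c => cF * α₁ * (if a = a' then (1 : ℝ) else 0)) fun a a' => by
      split_ifs
      · rw [mul_one]; exact hcle
      · rw [mul_zero]
  -- r06's C-clause on the block carrier `(BlkCubeY i □ × ι, Prod.fst)`
  obtain ⟨Tinv, hT1, hT2, hTm⟩ := H34 (shiftY i) (fun _ _ => (1 : 𝔸ˣ)) (g := geoCK i c) (Rr := Rr) (H := H) (blkCubeY i c)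
    (fun q : BlkCubeY i c × ι => q.1) (kQCubeY i c par (fun _ _ => 1)) (sQCubeY i c par (fun _ _ => 1)) (cfunK i c) (wK i c)
    hdnn htri hrefl hsym (geoCK_len_pos i c) (geoCK_eta_le_len i c) (geoCK_eta_pos i c)
    (fun α hα hα1 => h261 i c Rr H hN2 α hα hα1.le) (hST_geoCK i c hδ₀ hT2)
    (fun _ _ => ⟨h1, by rw [inv_one, Units.val_one]; exact h1⟩) hd₀B hd₀F hd₀0 (wK_nonneg i c) (card_block_mul_wK_le i c)
    (fun y x hx => by rw [← hx]; exact norm_kQCubeY_one_le i c par h1 hpar _ x) (norm_sQCubeY_one_le i c par h1 hpar) (abs_cfunK_le i c)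
    g342_1 g342_2 hQc hQcs hLinv h348 α₁ hα0 (hα1.trans (min_le_right _ _)) (chartA i (cutFldY i (chiTY i c) A))
    (kFCubeY i c par (fun _ _ => 1) (locCfgY i c (kGeo i).eta A)) (sFCubeY i c par (fun _ _ => 1) (locCfgY i c (kGeo i).eta A))
    hkF hsF h337B hA hAτB (conjHom_restrictScalars_eq_add b _ _) (conjHom_restrictScalars_eq_add b _ _) hFc hFcs
  rw [hW, conjHom_Qp_conj_sq_Qps_eq] at hT1 hT2
  obtain ⟨hunitX, hTinv⟩ := eq_conj_XinvCubeY_of_laws b i c par _ hT1 hT2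
  refine ⟨hunitX, ?_⟩
  rw [← hTinv]
  refine hasMajorant_mono (g := toB6 (geoCK i c) Rr H) _ hTm fun a a' => ?_
  have hℓ4 : 0 ≤ (geoCK i c).len a ^ (-(4 : ℝ)) := Real.rpow_nonneg (geoCK_len_pos i c a).le _
  have hexp : 0 ≤ Real.exp (-(9 / 25 * δ₀ * (geoCK i c).dist a a')) := (Real.exp_pos _).le
  nlinarith [mul_nonneg hℓ4 hexp]

end Main

end Literature.MathematicalPhysics.QuantumFieldTheory.Balaban1983to89.B9Cor35CinvAtCubeLetters

end
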